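import Literature.InformationTheory.QuantumCodes.LocalCodeEnergyBarrier
import Literature.InformationTheory.QuantumCodes.LocalCodeDistanceBoundPeriodic
import Literature.InformationTheory.QuantumCodes.LocalCodeTradeoffTorus
import HarnessLib

/-!
# Bravyi–Terhal 2009, Theorem 2 with periodic boundary conditions — proof

S. Bravyi, B. Terhal, arXiv:0810.1983 [BravyiTerhal2009], §1.2 Thm. 2 (chunk p0006 L30–35) and «We remark that
Theorem 2 applies to both open and periodic boundary conditions» (p0006 L41–42); the proof (p0010 L36–49) runs on
the strip logical operator of Prop. 1, which on the torus needs `L ≥ 2(r−1)²` (§2 Prop. 1, the balanced partition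
of the circle into an even number of strips, formalised in `LocalCodeDistanceBoundPeriodic.lean`).

THIS FILE PROVES the torus case left as `TODO(general form)` in `LocalCodeEnergyBarrier.lean`:
`BravyiTerhal2009_theorem2_periodic` — on the `L × L` torus (`L ≥ 2(r−1)²`), for `S̄ = ⟨g_a⟩` with `k ≥ 1`, every
generator inside an `r × r` window taken modulo `L` and every qubit in at most `g_max` generators, there is a
non-trivial logical operator `E ∈ S̄⊥ ∖ S̄` and a walk `0 = P_0, …, P_{L²} = E` on the Pauli group with
`ε(P_i) ≤ 4 r² g_max` throughout (two fronts: the sweeping row and the seam row `0 ∼ L`).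

Steps: the strip logical on the torus (`exists_logical_in_columns_periodic`, the contrapositive of the core
`sympDual_le_of_slabs'` on the balanced slab index of `BravyiTerhal2009_thm1_periodic_holds`, whose construction is
repeated here because that proof keeps it internal); the row-by-row walk `EnergyBarrier.rowWalk`; the periodic front
estimate `energyCost_prefixWalk_le_periodic` (a generator anticommuting with `ρ_{U_i} E` meets `supp E` at an applied
qubit lying in the strip columns and either fewer than `r` rows below the front or in the first `r` rows — the seam).

## Mathlib / tree search

Tree: `EnergyBarrier.{prefixWalk, rowIndex, rowWalk, rowWalk_zero, rowWalk_last, isPauliWalk_rowWalk,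
exists_crossing_of_sympInner_prefixWalk_ne_zero}`, `energyCost`, `IsPauliWalk` (LocalCodeEnergyBarrier.lean);
`sympDual_le_of_slabs'`, `exists_slabBoundaries`, `slabOf`, `slabOf_mono`, `slabOf_le_succ`, `slabOf_wrap`,
`card_filter_slabOf_le`, `periodic_window_cases` (LocalCodeDistanceBoundPeriodic.lean); `BPTTorus.close_of_inCubePeriodic`,
`BPTTorus.Close` (LocalCodeTradeoffTorus.lean); `slab`, `IsCubeLocalPeriodic`, `InCubePeriodic`.
-/

namespace Literature.InformationTheory.QuantumCodes

open Finset Module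
open Classical

variable {n : ℕ}

namespace EnergyBarrier

/-! ### The strip logical operator on the torus -/

section Strip

variable {L : ℕ} {ι : Type*} {g : ι → SympVec n} {S : Submodule (ZMod 2) (SympVec n)}

/-- **A set of `≤ r` columns of the torus supports a non-trivial logical operator** (Prop. 1 on the torus,
`L ≥ 2(r−1)²`; the contrapositive reading of the periodic core `sympDual_le_of_slabs'` for `k ≥ 1`, on the balanced
slab index of the periodic Theorem 1). [cite: BravyiTerhal2009, §2 Prop. 1 (periodic boundary conditions, «for any L ≥ 2(r−1)²») and the proof of Thms. 1–2 (p. 10)] -/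
theorem exists_logical_in_columns_periodic {D' k d r : ℕ} (e : Fin n ≃ (Fin (D' + 1) → Fin L)) (hr : 1 ≤ r)
    (hL : 2 * (r - 1) ^ 2 ≤ L) (hS : S = Submodule.span (ZMod 2) (Set.range g))
    (hg : ∀ a, IsCubeLocalPeriodic e r (g a)) (hcode : IsAdditiveCode S k d) (hk : 1 ≤ k) :
    ∃ C : Finset (Fin L), #C ≤ r ∧ ∃ Q ∈ sympDual S, Q ∉ S ∧
      Q ∈ supportedOn (univ.filter fun q => e q 0 ∈ C) := by
  -- a slab index β with parity separation, slabs inside ≤ r columns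
  obtain ⟨β, hsep, hcols⟩ : ∃ β : Fin n → ℕ,
      (∀ a, ∀ q ∈ sympSupport (g a), ∀ q' ∈ sympSupport (g a), β q % 2 = β q' % 2 → β q = β q') ∧
      (∀ j, ∃ C : Finset (Fin L), #C ≤ r ∧ ∀ q, β q = j → e q 0 ∈ C) := by
    rcases Nat.lt_or_ge r 2 with hr1 | hr2
    · -- r = 1: slabs = single columns
      have hr1' : r = 1 := by omega
      subst hr1'
      refine ⟨fun q => ((e q) 0 : ℕ), ?_, ?_⟩
      · intro a q hq q' hq' _
        dsimp only
        obtain ⟨c, hc⟩ := hg a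
        have h1 := periodic_window_cases (hc q hq 0)
        have h2 := periodic_window_cases (hc q' hq' 0)
        have := ((e q) 0).isLt
        have := ((e q') 0).isLt
        have := (c 0).isLt
        omega
      · intro j
        refine ⟨univ.filter fun t : Fin L => (t : ℕ) = j, ?_, fun q hq => by simpa using hq⟩
        rw [Finset.card_le_one]
        intro a ha b hb
        simp only [mem_filter, mem_univ, true_and] at ha hb
        exact Fin.ext (by omega)
    · -- r ≥ 2: balanced partition of the circle into an even number of slabs of widths r-1, r
      obtain ⟨K, t, ht, hKeven, hKpos⟩ :=
        exists_slabBoundaries (u := r - 1) (L := L) (by omega)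
          (by have : 2 * (r - 1) * (r - 1) = 2 * (r - 1) ^ 2 := by ring
              omega)
      refine ⟨fun q => slabOf ht hKpos ((e q) 0 : ℕ), ?_, ?_⟩
      · intro a q hq q' hq' hpar
        dsimp only at hpar ⊢
        obtain ⟨c, hc⟩ := hg a
        have h1 := periodic_window_cases (hc q hq 0)
        have h2 := periodic_window_cases (hc q' hq' 0)
        have hx := ((e q) 0).isLt
        have hx' := ((e q') 0).isLt
        have hc₀L := (c 0).isLt
        set x : ℕ := ((e q) 0 : ℕ) with hxdef
        set x' : ℕ := ((e q') 0 : ℕ) with hx'def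
        set c₀ : ℕ := ((c 0 : Fin L) : ℕ) with hc₀
        have hK2 : 2 ≤ K := by omega
        have nowrap : ∀ {y y' : ℕ}, y ≤ y' → y' ≤ y + (r - 1) → y' < L →
            slabOf ht hKpos y % 2 = slabOf ht hKpos y' % 2 → slabOf ht hKpos y = slabOf ht hKpos y' := by
          intro y y' hyy' hy'u hy'L hp
          have a1 := slabOf_mono ht hKpos hyy' hy'L
          have a2 := slabOf_le_succ ht hKpos hyy' hy'u hy'L
          omega
        have wrap : ∀ {y y' : ℕ}, y < L → y' < L → y' + L ≤ y + (r - 1) →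
            slabOf ht hKpos y % 2 ≠ slabOf ht hKpos y' % 2 := by
          intro y y' hyL hy'L hw
          obtain ⟨b1, b2⟩ := slabOf_wrap ht hKpos hyL hy'L hw
          rw [b1, b2]
          omega
        rcases h1 with ⟨h1a, h1b⟩ | ⟨h1a, h1b⟩ <;> rcases h2 with ⟨h2a, h2b⟩ | ⟨h2a, h2b⟩
        · rcases le_total x x' with hle | hle
          · exact nowrap hle (by omega) hx' hpar
          · exact (nowrap hle (by omega) hx hpar.symm).symm
        · exact absurd hpar (wrap hx hx' (by omega))
        · exact absurd hpar.symm (wrap hx' hx (by omega))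
        · rcases le_total x x' with hle | hle
          · exact nowrap hle (by omega) hx' hpar
          · exact (nowrap hle (by omega) hx hpar.symm).symm
      · intro j
        refine ⟨univ.filter fun c : Fin L => slabOf ht hKpos c = j,
          (card_filter_slabOf_le ht hKpos j).trans (by omega), fun q hq => by simpa using hq⟩
  -- no slab supports a logical ⇒ S̄⊥ ≤ S̄ ⇒ k = 0
  by_contra hnone
  push Not at hnone
  have h0 : ∀ j, ∀ Q ∈ sympDual S, Q ∈ supportedOn (slab β j) → Q ∈ S := by
    intro j Q hQd hQs
    obtain ⟨C, hC, hCq⟩ := hcols j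
    by_contra hQS
    refine hnone C hC Q hQd hQS fun i hi => hQs i fun hij => hi ?_
    rw [mem_slab] at hij
    exact mem_filter.2 ⟨mem_univ _, hCq i hij⟩
  have hle := Submodule.finrank_mono (sympDual_le_of_slabs' β g hS hcode.1 hsep h0)
  rw [hcode.finrank_sympDual] at hle
  have hdim := hcode.2.1
  omega

end Strip

/-! ### The front on the torus -/

section Front

variable {L : ℕ} {e : Fin n ≃ (Fin 2 → Fin L)}

/-- Quotient and remainder of the row-major index. [folklore] -/
private theorem rowIndex_div_mod' (hL : 0 < L) (q : Fin n) :
    rowIndex e q / L = (e q 1 : ℕ) ∧ rowIndex e q % L = (e q 0 : ℕ) := by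
  have hx := (e q 0).isLt
  unfold rowIndex
  constructor
  · rw [Nat.add_comm, Nat.add_mul_div_right _ _ hL, Nat.div_eq_of_lt hx, zero_add]
  · rw [Nat.add_comm, Nat.add_mul_mod_self_right, Nat.mod_eq_of_lt hx]

/-- **The two fronts cost `O(1)` energy on the torus.** If `E` commutes with every generator, is supported on the
columns `C`, every generator lies in a periodic `r × r` window and every qubit in at most `g_max` generators, then
every partially implemented `ρ_{U_i} E` (row-major prefix) has energy cost `≤ 2 · (2r·|C|) · g_max`: an anticommuting
generator meets `supp E` at an applied qubit of the columns `C` that lies fewer than `r` rows below the front row, or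
in the first `r` rows (the window wraps around the seam).
[cite: BravyiTerhal2009, §2 proof of Thm. 2 (p. 10: «the contribution to the energy cost of a partially implemented P comes only from the two end-points of the string») with «Theorem 2 applies to both open and periodic boundary conditions» (p. 6)] -/
theorem energyCost_prefixWalk_le_periodic {ι : Type*} [Fintype ι] {g : ι → SympVec n} {r gmax : ℕ} (hL : 0 < L)
    (hr : 1 ≤ r) (hg : ∀ a, IsCubeLocalPeriodic e r (g a))
    (hdeg : ∀ q : Fin n, #(univ.filter fun a => q ∈ sympSupport (g a)) ≤ gmax) {E : SympVec n}
    (hE : ∀ a, sympInner (g a) E = 0) {C : Finset (Fin L)}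
    (hEs : E ∈ supportedOn (univ.filter fun q => e q 0 ∈ C)) (i : ℕ) :
    energyCost g (prefixWalk (rowIndex e) E i) ≤ 2 * (#C * (r + r)) * gmax := by
  unfold energyCost
  set y₀ := i / L with hy₀
  obtain ⟨t, rfl⟩ : ∃ t, r = t + 1 := ⟨r - 1, by omega⟩
  -- applied qubits of the columns C near the front or near the seam
  set R : Finset (Fin n) := univ.filter fun q =>
    e q 0 ∈ C ∧ (((e q 1 : ℕ) ≤ y₀ ∧ y₀ < (e q 1 : ℕ) + (t + 1)) ∨ (e q 1 : ℕ) < t + 1) with hR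
  have hRcard : #R ≤ #C * (t + 1 + (t + 1)) := by
    calc #R ≤ #(C ×ˢ (Finset.Ico (y₀ - t) (y₀ + 1) ∪ Finset.range (t + 1))) := by
          refine card_le_card_of_injOn (fun q => (e q 0, (e q 1 : ℕ))) ?_ ?_
          · intro q hq
            have hq' := (mem_filter.1 (mem_coe.1 hq)).2
            simp only [coe_product, Set.mem_prod, mem_coe, mem_union, Finset.mem_Ico, Finset.mem_range]
            refine ⟨hq'.1, ?_⟩
            omega
          · intro q _ q' _ h
            simp only [Prod.mk.injEq] at h
            apply e.injective
            funext j'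
            fin_cases j'
            · exact h.1
            · exact Fin.ext h.2
      _ ≤ #C * (t + 1 + (t + 1)) := by
          rw [card_product]
          refine Nat.mul_le_mul_left _ ((card_union_le _ _).trans ?_)
          rw [Nat.card_Ico, card_range]
          omega
  have hsub : (univ.filter fun a => sympInner (g a) (prefixWalk (rowIndex e) E i) ≠ 0) ⊆
      R.biUnion (fun q => univ.filter fun a => q ∈ sympSupport (g a)) := by
    intro a ha
    simp only [mem_filter, mem_univ, true_and] at ha
    obtain ⟨⟨q₁, hq₁a, hq₁E, hq₁i⟩, ⟨q₂, hq₂a, hq₂E, hq₂i⟩⟩ :=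
      exists_crossing_of_sympInner_prefixWalk_ne_zero (hE a) ha
    rw [mem_biUnion]
    refine ⟨q₁, ?_, by simpa using hq₁a⟩
    obtain ⟨c, hc⟩ := hg a
    -- q₁ lies in the columns C
    have hcol : e q₁ 0 ∈ C := by
      by_contra hne
      have h0 := hEs q₁ (by simpa using hne)
      simp only [sympSupport, mem_filter, mem_univ, true_and] at hq₁E
      rcases hq₁E with h | h
      · exact h h0.1
      · exact h h0.2
    -- rows: q₁ applied, q₂ not: y₁ ≤ y₀ ≤ y₂; the window has height t + 1 (cyclically)
    have hd1 := rowIndex_div_mod' (e := e) hL q₁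
    have hd2 := rowIndex_div_mod' (e := e) hL q₂
    have hy₁ : (e q₁ 1 : ℕ) ≤ y₀ := by
      rw [← hd1.1, hy₀]; exact Nat.div_le_div_right hq₁i.le
    have hy₂ : y₀ ≤ (e q₂ 1 : ℕ) := by
      rw [← hd2.1, hy₀]; exact Nat.div_le_div_right hq₂i
    have hclose := BPTTorus.close_of_inCubePeriodic (e := e) (hc q₁ hq₁a) (hc q₂ hq₂a) 1
    have := (e q₁ 1).isLt
    have := (e q₂ 1).isLt
    rw [hR, mem_filter]
    refine ⟨mem_univ _, hcol, ?_⟩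
    unfold BPTTorus.Close at hclose
    omega
  calc 2 * #(univ.filter fun a => sympInner (g a) (prefixWalk (rowIndex e) E i) ≠ 0)
      ≤ 2 * #(R.biUnion fun q => univ.filter fun a => q ∈ sympSupport (g a)) :=
        Nat.mul_le_mul_left _ (card_le_card hsub)
    _ ≤ 2 * ∑ q ∈ R, #(univ.filter fun a => q ∈ sympSupport (g a)) :=
        Nat.mul_le_mul_left _ card_biUnion_le
    _ ≤ 2 * ∑ _q ∈ R, gmax := Nat.mul_le_mul_left _ (sum_le_sum fun q _ => hdeg q)
    _ = 2 * (#R * gmax) := by rw [sum_const, smul_eq_mul]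
    _ ≤ 2 * (#C * (t + 1 + (t + 1)) * gmax) := by gcongr
    _ = 2 * (#C * (t + 1 + (t + 1))) * gmax := by ring

end Front

end EnergyBarrier

open EnergyBarrier in
/-- **Bravyi–Terhal 2009, Theorem 2 on the torus — proved** («Theorem 2 applies to both open and periodic boundary
conditions»; here periodic, in the range `L ≥ 2(r−1)²` of the torus Prop. 1). For a self-orthogonal `S̄ = ⟨g_a⟩`
with `k ≥ 1` on the `L × L` torus, every generator inside an `r × r` window modulo `L` (`r ≥ 1`), every qubit in at
most `g_max` generators: there is `E ∈ S̄⊥ ∖ S̄` and a walk `0 = P_0, …, P_{L²} = E` (consecutive classes differ on at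
most one qubit) with `ε(P_i) ≤ 4 r² g_max` for every `i`; hence `d‡ ≤ 4 r² g_max`, independent of `L`. Column: proved
theorem. [cite: BravyiTerhal2009, §1.2 Thm. 2 (p. 6) with «applies to both open and periodic boundary conditions» (p. 6) and the proof on p. 10] -/
theorem BravyiTerhal2009_theorem2_periodic {L n k d : ℕ} (r gmax : ℕ) (e : Fin n ≃ (Fin 2 → Fin L)) {ι : Type*}
    [Fintype ι] (g : ι → SympVec n) {S : Submodule (ZMod 2) (SympVec n)} (hr : 1 ≤ r)
    (hL : 2 * (r - 1) ^ 2 ≤ L) (hS : S = Submodule.span (ZMod 2) (Set.range g))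
    (hg : ∀ a, IsCubeLocalPeriodic e r (g a))
    (hdeg : ∀ q : Fin n, #(univ.filter fun a => q ∈ sympSupport (g a)) ≤ gmax) (hcode : IsAdditiveCode S k d)
    (hk : 1 ≤ k) :
    ∃ E ∈ sympDual S, E ∉ S ∧ ∃ (m : ℕ) (γ : Fin (m + 1) → SympVec n),
      γ 0 = 0 ∧ γ (Fin.last m) = E ∧ IsPauliWalk γ ∧ ∀ i, energyCost g (γ i) ≤ 4 * r ^ 2 * gmax := by
  have hn : n = L ^ 2 := by simpa using Fintype.card_congr e
  have hLpos : 0 < L := by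
    rcases Nat.eq_zero_or_pos L with h | h
    · exfalso
      rw [h] at hn
      simp at hn
      have := hcode.2.1
      omega
    · exact h
  obtain ⟨C, hC, Q, hQd, hQS, hQs⟩ := exists_logical_in_columns_periodic (D' := 1) e hr hL hS hg hcode hk
  have hE : ∀ a, sympInner (g a) Q = 0 := fun a =>
    (mem_sympDual_iff.1 hQd) (g a) (by rw [hS]; exact Submodule.subset_span ⟨a, rfl⟩)
  refine ⟨Q, hQd, hQS, L * L, rowWalk e Q, rowWalk_zero Q, rowWalk_last Q, isPauliWalk_rowWalk hLpos Q,
    fun i => ?_⟩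
  calc energyCost g (rowWalk e Q i) ≤ 2 * (#C * (r + r)) * gmax :=
        energyCost_prefixWalk_le_periodic hLpos hr hg hdeg hE hQs i
    _ ≤ 2 * (r * (r + r)) * gmax := by gcongr
    _ = 4 * r ^ 2 * gmax := by ring

end Literature.InformationTheory.QuantumCodes
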